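import Summits.CriticalPhenomena.PercolationContinuityZ3.Theorems.Transplant.SkelNeg1ClosureL
import HarnessLib

/-!
# N1 (the {±1} node), the RE-ORDERED CLOSURE at the CHOICE level, LENGTH-BUDGETED FORM (NEG-SCOPE §B.19/B.20, ruling Q-ζ1 03:03Z; design
# owner p3-g11): over the RECORD's constants `SkelConc.Consts` and the RECORD's oriented choice functions `ChoiceFnNO` — the two facts the
# closure hands down (`FlatL`, `ChainFactL`), the three residue obligations in length-budgeted form (Root GIVEN `FlatL`; Face GIVEN
# `FlatL + ChainFactL`; Reach := `∃ nmax ≤ Lf K₀, Skel.ReachOblRHN G nmax … (κ.δr 0)` at the FLAT ROOT ACCURACY), and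
# **`samePDropOfSkeletonNeg₁_of_choiceFnNOWL`**

builds on p205010 (kernel theorem, internal audit signed; external expert review pending) through `samePDropOfSkeletonNeg₁_of_residuesNOWL`.
`SamePDropOfSkeletonNeg₁` stays OPEN; the interface of record (`ChoiceNO`, p282003), the closure of record (`…_of_choiceFnNOW`, p286999),
the geometric obligation `GeomHoldsNOFn` and the choice-function type `ChoiceFnNO` are REUSED AS THEY ARE; the `δC` variant (`SkelNeg1ChoiceA`,
p315351) is superseded by this file (it stays in the tree, unused).  This is the closure top the design owner proposes for adoption.
Lane `prim-bschramm`, seat `prim-bschramm-p3` (gen 11; N1 design owner); helper file (`--supports stmt-CriticalPhenomena-4575`).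

* `FlatL Lf κ` — the root table of `κ : Consts` is flat on `[0, Lf K₀]`; `ChainFactL Lf G Δ κ` — the face inner-chain fact (kits at `κ.δr 0`,
  length `≤ Lf κ.K₀`, conclusion `1 − κ.δ₂²`); both are DISCHARGED by the closure and handed to the dischargers, indexed by the node₁ file's
  budget function `Lf : ℕ → ℕ`;
* `RootHoldsNOWFnL Lf` — the record's law-carrying root body GIVEN `FlatL Lf κ`; `FaceHoldsRNOFnL Lf` — the record's face body GIVEN
  `FlatL Lf κ` and `ChainFactL Lf G Φ.Δ κ`; `ReachHoldsRHNOFnL Lf` — the corridor body for SOME length `nmax ≤ Lf κ.K₀` with kits at the flat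
  root accuracy `κ.δr 0` (so ONE kit block at any accuracy `≤ κ.δr 0` serves root, faces and corridor);
* `rootHoldsNOWFnL_of` / `faceHoldsRNOFnL_of` — the record's obligations imply the budgeted ones (drop the antecedents);
* **`samePDropOfSkeletonNeg₁_of_choiceFnNOWL`** — an oriented choice function of record type meeting `GeomHoldsNOFn`, `RootHoldsNOWFnL Lf`,
  `FaceHoldsRNOFnL Lf`, `ReachHoldsRHNOFnL Lf` gives the node.
[cite: KozmaNitzan2024, §4 Theorem 6 (pp. 25–31); §1 p. 2 (approach 1)] [this work]
-/

noncomputable section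

open MeasureTheory ProbabilityTheory
open scoped ENNReal Classical

namespace Summit.CriticalPhenomena.PercolationContinuityZ3.Theorems.Transplant

open Literature.Probability.Percolation Literature.Probability.LatticeModels SimpleGraph KNCells KNLevels
open Literature.Barriers.CriticalPhenomena (HasExponentialGrowth)

namespace PlanarSkeletonNeg

open SkelConc (Consts)

/-! ## §1 The two handed-down facts over the record's constants -/

/-- **The root table is FLAT on `[0, Lf K₀]`** (a property of the constants the closure constructs, handed to the dischargers). [this work] -/
def FlatL (Lf : ℕ → ℕ) (κ : Consts) : Prop := ∀ n, n ≤ Lf κ.K₀ → κ.δr n = κ.δr 0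

/-- **The FACE INNER-CHAIN FACT handed down by the closure**: in every window graph `Skel.winGraph G c Rπ`, linked chains of
`n + 1 ≤ Lf κ.K₀ + 1` target steps with kits at the flat root accuracy `κ.δr 0`, excess `≤ κ.δr 0 / 2` and source at `1 − κ.δr 0` conclude
at `1 − κ.δ₂²` — the (F) keystone's bounded `hchain` binder in shape. [this work] -/
def ChainFactL (Lf : ℕ → ℕ) {V : Type} [DecidableEq V] [Countable V] (G : SimpleGraph V) [G.LocallyFinite] (Δ : ℕ) (κ : Consts) : Prop :=
  ∀ n, n ≤ Lf κ.K₀ → ∀ (q' : unitInterval), (q' : ℝ) < 1 →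
    ∀ (c : V) (Rπ : ℕ) (Wg : Sym2 V → unitInterval) (s : Fin (n + 1) → KNLevels.TStep (Skel.winGraph G c Rπ))
      (T' : Fin (n + 1) → Finset V) (η : ℝ),
      (∀ i : Fin (n + 1), (s i).L.o = (s 0).L.o) →
      (∀ i : Fin n, T' (Fin.castSucc i) ⊆ (s i.succ).L.X 0) →
      (∀ i : Fin (n + 1), T' i ⊆ (s i).T) →
      (∀ i : Fin (n + 1), (s i).KitsAt Wg q' Δ (κ.δr 0)) →
      η ≤ κ.δr 0 / 2 →
      (∀ i : Fin (n + 1), (prodBernoulli Wg).real (⋃ t ∈ (s i).T \ T' i, openConn (s 0).L.o t) ≤ η) →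
      1 - κ.δr 0 < (prodBernoulli Wg).real (s 0).L.reachB →
        1 - κ.δ₂ ^ 2 < (prodBernoulli Wg).real (⋃ t ∈ T' (Fin.last n), openConn (s 0).L.o t)

/-! ## §2 The three residue obligations, length-budgeted, over the record's `ChoiceFnNO` -/

/-- **The law-carrying root obligation GIVEN the flat root table on `[0, Lf K₀]`** (so a kit accuracy `≤ κ.δr 0` serves root chains of every
length `≤ Lf κ.K₀`: `Skel.RootOblTW` asks kits at `κ.δr N = κ.δr 0`). [this work] -/
def RootHoldsNOWFnL (Lf : ℕ → ℕ) (𝒞₀ : ChoiceFnNO) : Prop :=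
  ∀ (κ : Consts) {V : Type} [DecidableEq V] [Countable V] (G : SimpleGraph V) [G.LocallyFinite] (Φ : PlanarSkeletonNeg G)
    (hg : ¬ HasExponentialGrowth G) (t : V) (ht : t ∈ Φ.types) (h1 : Φ.types = {t}) (p : unitInterval) (hp0 : 0 < (p : ℝ)) (hp1 : (p : ℝ) < 1)
    (hC : Φ.CylSubcritical p), FlatL Lf κ → (𝒞₀ κ G Φ hg t ht h1 p hp0 hp1 hC).RootHoldsNOW

/-- **The face obligation GIVEN the flat root table and the face inner-chain fact.** [this work] -/
def FaceHoldsRNOFnL (Lf : ℕ → ℕ) (𝒞₀ : ChoiceFnNO) : Prop :=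
  ∀ (κ : Consts) {V : Type} [DecidableEq V] [Countable V] (G : SimpleGraph V) [G.LocallyFinite] (Φ : PlanarSkeletonNeg G)
    (hg : ¬ HasExponentialGrowth G) (t : V) (ht : t ∈ Φ.types) (h1 : Φ.types = {t}) (p : unitInterval) (hp0 : 0 < (p : ℝ)) (hp1 : (p : ℝ) < 1)
    (hC : Φ.CylSubcritical p), FlatL Lf κ → ChainFactL Lf G Φ.Δ κ → (𝒞₀ κ G Φ hg t ht h1 p hp0 hp1 hC).FaceHoldsRNO

/-- **The corridor obligation, LENGTH-BUDGETED, at the flat root accuracy**: at every `(O, q)` with the premises of step (B), for SOME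
`nmax ≤ Lf κ.K₀`, `Skel.ReachOblRHN G nmax` with kits at `κ.δr 0` (the (C) column picks its corridor length after `K₀`, within the node₁
file's budget). [this work] -/
def ReachHoldsRHNOFnL (Lf : ℕ → ℕ) (𝒞₀ : ChoiceFnNO) : Prop :=
  ∀ (κ : Consts) {V : Type} [DecidableEq V] [Countable V] (G : SimpleGraph V) [G.LocallyFinite] (Φ : PlanarSkeletonNeg G)
    (hg : ¬ HasExponentialGrowth G) (t : V) (ht : t ∈ Φ.types) (h1 : Φ.types = {t}) (p : unitInterval) (hp0 : 0 < (p : ℝ)) (hp1 : (p : ℝ) < 1)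
    (hC : Φ.CylSubcritical p) (O : Skelφ.StepI.OutO V) (q : unitInterval), (𝒞₀ κ G Φ hg t ht h1 p hp0 hp1 hC).AtQO O q →
      ∃ nmax : ℕ, nmax ≤ Lf κ.K₀ ∧ Skel.ReachOblRHN G nmax ((𝒞₀ κ G Φ hg t ht h1 p hp0 hp1 hC).scheme O q)
        ((𝒞₀ κ G Φ hg t ht h1 p hp0 hp1 hC).FD O q) Φ.Δ (κ.δr 0)

/-- The record's law-carrying root obligation implies the budgeted one (drop the flatness antecedent). [folklore] -/
theorem rootHoldsNOWFnL_of (Lf : ℕ → ℕ) {𝒞₀ : ChoiceFnNO} (h : RootHoldsNOWFn 𝒞₀) : RootHoldsNOWFnL Lf 𝒞₀ :=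
  fun κ _ _ _ G _ Φ hg t ht h1 p hp0 hp1 hC _ => h κ G Φ hg t ht h1 p hp0 hp1 hC

/-- The record's face obligation implies the budgeted one (drop the two antecedents). [folklore] -/
theorem faceHoldsRNOFnL_of (Lf : ℕ → ℕ) {𝒞₀ : ChoiceFnNO} (h : FaceHoldsRNOFn 𝒞₀) : FaceHoldsRNOFnL Lf 𝒞₀ :=
  fun κ _ _ _ G _ Φ hg t ht h1 p hp0 hp1 hC _ _ => h κ G Φ hg t ht h1 p hp0 hp1 hC

/-! ## §3 The node from an oriented choice function of record type -/

/-- **THE N1 PARTIAL CLOSURE, RE-ORDERED AND LENGTH-BUDGETED, oriented shared-choice form, root law-carrying**: an oriented choice function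
of the record's type meeting the record's geometric obligation, the law-carrying root obligation given flatness, the face obligation given
flatness and the inner-chain fact, and the budgeted corridor obligation at the flat root accuracy gives `SamePDropOfSkeletonNeg₁` (through
`samePDropOfSkeletonNeg₁_of_residuesNOWL`). [cite: KozmaNitzan2024, §4 Theorem 6 (pp. 25–31); §1 p. 2] [this work] -/
theorem samePDropOfSkeletonNeg₁_of_choiceFnNOWL (Lf : ℕ → ℕ) (𝒞₀ : ChoiceFnNO) (hGm : GeomHoldsNOFn 𝒞₀) (hR : RootHoldsNOWFnL Lf 𝒞₀)
    (hF : FaceHoldsRNOFnL Lf 𝒞₀) (hRe : ReachHoldsRHNOFnL Lf 𝒞₀) : SamePDropOfSkeletonNeg₁ := by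
  refine samePDropOfSkeletonNeg₁_of_residuesNOWL Lf
    fun K₀ δ δ₂ δr hδ0 hδ1 hδ₂0 hδ₂1 hδr hflat {V} _ _ G _ Φ hg t ht h1 p hp0 hp1 _ hC _ hCF => ?_
  set κ : Consts := ⟨K₀, δ, δ₂, δr, hδ0, hδ1, hδ₂0, hδ₂1, hδr⟩ with hκ
  have hflat' : FlatL Lf κ := hflat
  have hCF' : ChainFactL Lf G Φ.Δ κ := hCF
  set 𝒞 := 𝒞₀ κ G Φ hg t ht h1 p hp0 hp1 hC with h𝒞
  refine ⟨𝒞.δI, 𝒞.m₀, 𝒞.δI_pos, 𝒞.δI_lt_one, fun O hfacts => ?_⟩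
  obtain ⟨hSz, hSMn⟩ := 𝒞.S_adm O hfacts
  refine ⟨𝒞.Sz O, 𝒞.SMn O, hSz, hSMn, fun q hq1 hq2 hin hCq => ?_⟩
  have hat : 𝒞.AtQO O q := ⟨hfacts, hq1, hq2, hin, hCq⟩
  obtain ⟨hroot, hK, hrun, hanch, hsep, hexit, hsteps, hlev⟩ := hGm κ G Φ hg t ht h1 p hp0 hp1 hC O q hat
  obtain ⟨nmax, hnmax, hreach⟩ := hRe κ G Φ hg t ht h1 p hp0 hp1 hC O q hat
  exact ⟨ℕ, 𝒞.Γ O q, 𝒞.FD O q, 𝒞.LD O q, hroot, hK, hrun, hanch, hsep, hexit, hsteps, hlev,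
    hR κ G Φ hg t ht h1 p hp0 hp1 hC hflat' O q hat, hF κ G Φ hg t ht h1 p hp0 hp1 hC hflat' hCF' O q hat, nmax, hnmax, hreach⟩

end PlanarSkeletonNeg

end Summit.CriticalPhenomena.PercolationContinuityZ3.Theorems.Transplant

end
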